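import Summits.FinalStateConjecture.FinalStateConjecture.Theorems.ZeroEnergyKerrOrBombSymplecticDualOfTheBombSig4
import Summits.FinalStateConjecture.FinalStateConjecture.Theorems.ZeroEnergyKerrOrBombStationaryLimitReductionStubKerrIsometryRigidity
import Literature.Geometry.Lorentzian.CauchyProblemCauchy
import Literature.Geometry.Lorentzian.IsometricImmersionExp
import Literature.Geometry.Lorentzian.EinsteinTensorNaturality
import Literature.Geometry.Lorentzian.DocStationarySpacetime
import Literature.Geometry.Lorentzian.KerrBackwardsIsometry
import Literature.Geometry.Lorentzian.SchwarzschildKillingAlgebra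
import HarnessLib

/-!
# Route ZeroEnergyKerrOrBomb · crux `StationaryLimitReduction` (stmt-FinalStateConjecture-10021), line
# `symplectic-dual-of-the-bomb` — stub 1R `kerrIsometryRigidity`, wave 3: the two printed inputs
# (backwards isometry of Kerr, Killing algebra of Schwarzschild), the three residual obligations
# (end matching, horizon extension, asymptotic rigidity) as precise `Prop`s, and the consumer
# "WLOG the Kerr isometry is future-normalised"

Helper file (`--supports stmt-FinalStateConjecture-10021`; registered helper
`exists_futureNormalised_kerrExterior`) of the lead's wave-3 stub-worker for
`stub_kerrIsometryRigidity : Sig4.stub_kerrIsometryRigidity` (lead prover-line-stmt-FinalStateConjecture-10021-a2-0,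
2026-08-16). Companion of `…StationaryLimitReductionStubKerrIsometryRigidity` (p116587) and of the wave-3
assembly file `…KerrIsometryRigidityWave3` (which proves
`Sig4.stub_kerrIsometryRigidity` from the named facts and the three `Prop`s below).

* §1 two PRINTED inputs of stub 1R, written by this worker as cited named facts and LANDED in
  `Literature/` (p124901, p124902; imported here): `ONeill1995_kerrBackwardsIsometry` (the isometry `(t, φ) ↦ (−t, −φ)` of the Kerr exterior
  block, reversing `∂_{t*}`; input F2) and `StephaniEtAl2003_schwarzschildKillingFields` (the Killing algebra
  `ℝ ∂_t ⊕ so(3)` of the Schwarzschild exterior, the `a = 0` companion of `ONeill1995_kerrKillingFields`; input F1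
  for `a = 0`);
* §2 the three RESIDUAL OBLIGATIONS of stub 1R as precise propositions over the tree's vocabulary (definitions
  only, nothing asserted; they are this line's obligations, not published facts, hence carry `(ref: …)` prose and
  no cite tag): `KerrEndMatching` (F0: the abstract Kerr isometry sends Kerr's spatial infinity into the far
  cylinder of the adapted chart), `KerrHorizonExtension` (F3: a future-normalised `T`-equivariant d.o.c. isometry
  extends smoothly and injectively across the future event horizon into the collar charted by `A`),
  `KerrAsymptoticRigidity` (F4: a `T`-equivariant isometry from the Kerr–Schild form to an asymptotically
  Schwarzschildean adapted chart which sends infinity to infinity has bounded tilt, bounded radial distortion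
  and bounded derivatives of orders `1–3`);
* §3 the registered consumer of F2, `exists_futureNormalised_kerrExterior`: an injective isometric immersion
  `Ψ` of the Kerr exterior onto the d.o.c. with `dΨ(∂_{t*}) = d T`, `d ≠ 0`, can be replaced by one with
  `dΨ'(∂_{t*}) = c T`, `c > 0` (precompose with the backwards isometry when `d < 0`).

References: B. O'Neill, *The Geometry of Kerr Black Holes* (1995), Ch. 2 §2.1 (Remark 4 after Table 2.1),
§2.5, Ch. 3 §3.1 (the backwards isometry `β`), §3.7; R. M. Wald, *General Relativity* (1984), §6.1 (time
reflection of static space-times), §6.4; H. Stephani, D. Kramer, M. MacCallum, C. Hoenselaers, E. Herlt,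
*Exact Solutions of Einstein's Field Equations*, 2nd ed. (2003), §15.4 (15.19), §38.2 (after Table 38.1);
P. T. Chruściel, J. L. Costa, arXiv:0806.0016, Thm. 1.3, §4.3 (Thm. 4.11); R. Bartnik, CPAM 39 (1986),
Cor. 3.2; B. O'Neill, *Semi-Riemannian Geometry* (1983), Ch. 3, pp. 58, 90–91.
-/

-- every `Summit.FinalStateConjecture.FinalStateConjecture.…` name repeats the summit = sub-problem segment (D-0017 layout)
set_option linter.dupNamespace false

noncomputable section

open scoped Manifold ContDiff Topology RealInnerProductSpace
open Set Filter Function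

namespace Summit.FinalStateConjecture.FinalStateConjecture.Theorems.SymplecticDualOfTheBomb

open Summit.FinalStateConjecture.FinalStateConjecture.Theorems.OneLockedExplosion
open Literature.Geometry.Lorentzian

/-! ## §1 Two printed inputs (cited named facts, LANDED in `Literature/`)

The two printed inputs of stub 1R written by this worker are the Literature named facts
`Literature.Geometry.Lorentzian.ONeill1995_kerrBackwardsIsometry` (`KerrBackwardsIsometry.lean`, p124901: the
involutive isometry of the Kerr exterior block reversing `∂_{t*}`, O'Neill 1995 §3.1; input F2) and
`Literature.Geometry.Lorentzian.StephaniEtAl2003_schwarzschildKillingFields` (`SchwarzschildKillingAlgebra.lean`,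
p124902: every Killing field of the Schwarzschild exterior is `α ∂_{t*} + (0, W₀ x⃗)`, `W₀ ∈ so(3)`, Stephani et
al. 2003 §38.2 with §15.4; input F1 for `a = 0`). They are imported, not restated. -/

/-! ## §2 The three residual obligations of stub 1R (definitions; nothing is asserted) -/

/-- **F0 · end matching** (residual obligation of stub 1R, wave 3): for a telescope hole `𝓑`, `I⁺`-regular,
read in a horizon-covering, asymptotically Cartesian and asymptotically Schwarzschildean adapted chart `A`,
every injective isometric immersion `Ψ` of a sub-extremal Kerr exterior ONTO the d.o.c. sends Kerr's spatial
infinity into the far cylinder of `A`: the `A`-radius of the chart preimage of `Ψ x` tends to `+∞` with the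
Kerr–Schild radius of `x`. Classical content: `A⁻¹ ∘ Ψ` is a homeomorphism of the exterior onto the chart
preimage of the d.o.c.; of the two ends of the exterior (horizon, infinity) exactly one goes to the far
cylinder (connectedness), and it is not the horizon end because `g(T, T) → −1` on the far cylinder while the
Killing field `Ψ^*T = α ∂_{t*} + β ∂_φ` (O'Neill 1995, Cor. 3.7.4; `a = 0`: `α ∂_t + so(3)`) satisfies
`g ≥ 0` on `{r = r₊}`. Not in print as a statement (it is the unwritten "ends go to ends" step of every chart
identification); provable in the tree from the two Killing-algebra facts (wave-3 report).
(ref: ChruscielCosta2008, Thm. 1.3 and §2.2) -/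
def KerrEndMatching : Prop :=
  ∀ [Kerr.Facts] (𝓑 : StationaryAFBlackHole.{0}) (A : 𝓑.AdaptedChart) (M a : ℝ)
    (Ψ : Kerr.exterior M a → 𝓑.carrier),
    InTelescope 𝓑 → 𝓑.IsIPlusRegular → 𝓑.horizon ⊆ Set.range A.toFun →
    ChartIsAsymptoticallyCartesian A → ChartIsAsymptoticallySchwarzschildean' A →
    Kerr.IsSubextremal M a → Function.Injective Ψ → Set.range Ψ = 𝓑.doc →
    PseudoRiemannianMetric.IsIsometricImmersion
      (Kerr.smoothMetric M a (Kerr.rPlus M a)).toPseudoRiemannianMetric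
      𝓑.metric.toPseudoRiemannianMetric Ψ →
    ∀ R₁ : ℝ, ∃ R : ℝ, ∀ x : Kerr.exterior M a, R ≤ Kerr.radius a x.1 →
      R₁ ≤ A.radius (chartPreimage A (Ψ x))

/-- **F3 · horizon extension** (residual obligation of stub 1R; NONE-EXISTS in print as a theorem — the
ingredients are Chruściel–Costa 2008 §4.1–4.3, Prop. 4.1–4.8 and Thm. 4.11, smoothness of `𝓔⁺` under
`I⁺`-regularity): for a telescope hole `𝓑`, `I⁺`-regular, read in a horizon-covering asymptotically
Cartesian adapted chart `A`, an injective isometric immersion `Ψ` of the sub-extremal Kerr exterior onto the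
d.o.c. which is FUTURE-NORMALISED and `T`-equivariant (`dΨ (∂_{t*}) = c T`, `c > 0`) extends to a map `Φ`
on a horizon-penetrating Kerr–Schild region `{r > r₀}`, `r₋ < r₀ < r₊`, which is smooth and injective there,
valued in `range A`, infinitesimally `T`-equivariant with the same constant, and agrees with `Ψ` on the
exterior — i.e. `C^∞` boundary regularity of the d.o.c. isometry at the future event horizons read in
horizon-regular charts (ingoing Kerr–Schild for Kerr, `A ⊇ 𝓗⁺` for `𝓑`) followed by any smooth injective
equivariant continuation into the collar; no isometry is asked on `{r₀ < r ≤ r₊}`. These are exactly the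
hypotheses of the landed reduction `isKerrChartedWith_of_chartedExtension` (p116587) minus the asymptotic
clause. (ref: ChruscielCosta2008, Thm. 1.3 with §4.3 Thm. 4.11) -/
def KerrHorizonExtension : Prop :=
  ∀ [Kerr.Facts] (𝓑 : StationaryAFBlackHole.{0}) (A : 𝓑.AdaptedChart) (M a c : ℝ)
    (Ψ : Kerr.exterior M a → 𝓑.carrier),
    InTelescope 𝓑 → 𝓑.IsIPlusRegular → 𝓑.horizon ⊆ Set.range A.toFun →
    ChartIsAsymptoticallyCartesian A → Kerr.IsSubextremal M a → 0 < c →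
    Function.Injective Ψ → Set.range Ψ = 𝓑.doc →
    PseudoRiemannianMetric.IsIsometricImmersion
      (Kerr.smoothMetric M a (Kerr.rPlus M a)).toPseudoRiemannianMetric
      𝓑.metric.toPseudoRiemannianMetric Ψ →
    (∀ x : Kerr.exterior M a,
      mfderiv 𝓘(ℝ, E4) (𝓡 4) Ψ x (E4.basisVector 0) = c • 𝓑.killing (Ψ x)) →
    ∃ (r₀ : ℝ) (Φ : E4 → 𝓑.carrier), Kerr.rMinus M a < r₀ ∧ r₀ < Kerr.rPlus M a ∧
      ContMDiffOn 𝓘(ℝ, E4) (𝓡 4) ∞ Φ (Kerr.region a r₀ : Set E4) ∧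
      Set.InjOn Φ (Kerr.region a r₀ : Set E4) ∧
      Set.MapsTo Φ (Kerr.region a r₀ : Set E4) (Set.range A.toFun) ∧
      (∀ x ∈ (Kerr.region a r₀ : Set E4),
        mfderiv 𝓘(ℝ, E4) (𝓡 4) Φ x (E4.basisVector 0) = c • 𝓑.killing (Φ x)) ∧
      ∀ x : Kerr.exterior M a, Φ x.1 = Ψ x

/-- **F4 · asymptotic rigidity at `i⁰`** (residual obligation of stub 1R): in an asymptotically Cartesian
adapted chart `A`, asymptotically Schwarzschildean in `C²` at rate `r^{-(n+2)}` (`ChartIsAsymptoticallySchwarzschildean'`),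
a smooth `T`-equivariant (`Θ (x + s e₀) = Θ x + (c s) e₀`, `c > 0`) injective isometry `Θ` from the Kerr–Schild
form `Kerr.bilin M a` to the chart components `A.bilin` on the Kerr exterior, valued in `A.domain`, anchored,
and SENDING INFINITY TO INFINITY (`A.radius (Θ x) → ∞` with the Kerr–Schild radius — the output of F0), has
bounded tilt `|(Θ u)⁰ − c u⁰|`, bounded radial distortion `|r_A (Θ u) − r u|` and bounded derivatives of
orders `1 ≤ n ≤ 3` on `{r ≥ r₊ + 1}` — the asymptotic clause of `IsKerrChartedWith`. Classical content: on
bounded shells this is continuity + `T`-invariance; at infinity `c² g_A(e₀, e₀) ∘ Θ = g_{M,a}(e₀, e₀)` forces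
`c = 1`, the differentiated isometry law gives `D²Θ = O(r⁻²)`, `DΘ → 1 ⊕ R` (`R ∈ O(3)`), the masses agree,
and against the COMMON Schwarzschild background the error is `O(r⁻²)` with one derivative, whence
`Θ = (t + τ₀, R y) + O(1)` with `D^kΘ` bounded. The tree's Riemannian transition rigidity
(`TransitionRigidity.TransitionDecay.exists_rotation`, Bartnik 1986 Cor. 3.2, `α < 1`) yields only
`O(r^{1−α})` drift, not the `O(1)` bounds: the mass-matched second-order argument is not in the tree
(wave-3 report). (ref: Bartnik1986, §3 Cor. 3.2; ChruscielCosta2008, §2.1) -/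
def KerrAsymptoticRigidity : Prop :=
  ∀ (𝓑 : StationaryAFBlackHole.{0}) (A : 𝓑.AdaptedChart) (M a c : ℝ) (Θ : E4 → E4),
    ChartIsAsymptoticallyCartesian A → ChartIsAsymptoticallySchwarzschildean' A →
    Kerr.IsSubextremal M a → 0 < c →
    ContDiffOn ℝ ∞ Θ (Kerr.exterior M a : Set E4) →
    Set.InjOn Θ (Kerr.exterior M a : Set E4) →
    Set.MapsTo Θ (Kerr.exterior M a : Set E4) (A.domain : Set E4) →
    (∀ x ∈ (Kerr.exterior M a : Set E4), ∀ s : ℝ,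
      Θ (x + s • E4.basisVector 0) = Θ x + (c * s) • E4.basisVector 0) →
    (∀ x ∈ (Kerr.exterior M a : Set E4), ∀ v w : E4,
      A.bilin (Θ x) (fderiv ℝ Θ x v) (fderiv ℝ Θ x w) = Kerr.bilin M a x v w) →
    Θ '' (Kerr.exterior M a : Set E4) = {u : E4 | ∃ h : u ∈ A.domain, A.toFun ⟨u, h⟩ ∈ 𝓑.doc} →
    (∀ R₁ : ℝ, ∃ R : ℝ, ∀ x ∈ (Kerr.exterior M a : Set E4), R ≤ Kerr.radius a x → R₁ ≤ A.radius (Θ x)) →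
    ∃ L : ℝ, ∀ u ∈ (Kerr.exterior M a : Set E4), Kerr.rPlus M a + 1 ≤ Kerr.radius a u →
      |Θ u 0 - c * u 0| ≤ L ∧ |A.radius (Θ u) - Kerr.radius a u| ≤ L ∧
        ∀ n : ℕ, 1 ≤ n → n ≤ 3 → ‖iteratedFDeriv ℝ n Θ u‖ ≤ L

/-! ## §3 WLOG the Kerr isometry is future-normalised (registered consumer of F2) -/

/-- **Registered helper `exists_futureNormalised_kerrExterior`** ("WLOG `d > 0`", the consumer of the
backwards isometry F2): GIVEN `ONeill1995_kerrBackwardsIsometry`, an injective isometric immersion `Ψ` of the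
sub-extremal Kerr exterior onto `𝓑.doc` with `dΨ (∂_{t*}) = d T`, `d ≠ 0`, may be replaced by one with
`dΨ' (∂_{t*}) = c T` and `c > 0`: if `d > 0` take `Ψ' = Ψ`; if `d < 0` take `Ψ' = Ψ ∘ ι` with `ι` the backwards
isometry (`ι` is an involution, so `Ψ'` is injective with the same range; isometric immersions compose,
`IsIsometricImmersion.comp`; and `dΨ' e₀ = dΨ (dι e₀) = dΨ (−e₀) = (−d) T` by the chain rule). O'Neill 1995,
Ch. 3 §3.1; O'Neill 1983, Ch. 3, p. 58. [cite: ONeill1995, Ch. 3 §3.1 (backwards isometry β)] -/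
theorem exists_futureNormalised_kerrExterior : ∀ [Kerr.Facts] (𝓑 : StationaryAFBlackHole.{0}) (M a d : ℝ) (Ψ : Kerr.exterior M a → 𝓑.carrier), ONeill1995_kerrBackwardsIsometry → Kerr.IsSubextremal M a → Function.Injective Ψ → Set.range Ψ = 𝓑.doc → PseudoRiemannianMetric.IsIsometricImmersion (Kerr.smoothMetric M a (Kerr.rPlus M a)).toPseudoRiemannianMetric 𝓑.metric.toPseudoRiemannianMetric Ψ → d ≠ 0 → (∀ x : Kerr.exterior M a, mfderiv 𝓘(ℝ, E4) (𝓡 4) Ψ x (E4.basisVector 0) = d • 𝓑.killing (Ψ x)) → ∃ (c : ℝ) (Ψ' : Kerr.exterior M a → 𝓑.carrier), 0 < c ∧ Function.Injective Ψ' ∧ Set.range Ψ' = 𝓑.doc ∧ PseudoRiemannianMetric.IsIsometricImmersion (Kerr.smoothMetric M a (Kerr.rPlus M a)).toPseudoRiemannianMetric 𝓑.metric.toPseudoRiemannianMetric Ψ' ∧ ∀ x : Kerr.exterior M a, mfderiv 𝓘(ℝ, E4) (𝓡 4) Ψ' x (E4.basisVector 0) = c • 𝓑.killing (Ψ' x)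 := by
  intro _ 𝓑 M a d Ψ hF hMa hΨi hΨr hΨiso hd hΨT
  rcases lt_or_gt_of_ne hd with hneg | hpos
  · -- `d < 0`: precompose with the backwards isometry
    obtain ⟨ι, hιι, hιiso, hιT⟩ := hF M a hMa
    have hιinj : Function.Injective ι := fun x y hxy ↦ by rw [← hιι x, ← hιι y, hxy]
    have hιsurj : Function.Surjective ι := fun x ↦ ⟨ι x, hιι x⟩
    refine ⟨-d, Ψ ∘ ι, by linarith, hΨi.comp hιinj, ?_, hΨiso.comp hιiso, fun x ↦ ?_⟩
    · rw [Set.range_comp, hιsurj.range_eq, Set.image_univ, hΨr]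
    · have hΨd : MDifferentiableAt 𝓘(ℝ, E4) (𝓡 4) Ψ (ι x) :=
        (hΨiso.1 (ι x)).mdifferentiableAt (by simp)
      have hιd : MDifferentiableAt 𝓘(ℝ, E4) 𝓘(ℝ, E4) ι x :=
        (hιiso.1 x).mdifferentiableAt (by simp)
      have hc : mfderiv 𝓘(ℝ, E4) (𝓡 4) (Ψ ∘ ι) x (E4.basisVector 0) =
          mfderiv 𝓘(ℝ, E4) (𝓡 4) Ψ (ι x) (mfderiv 𝓘(ℝ, E4) 𝓘(ℝ, E4) ι x (E4.basisVector 0)) := by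
        rw [mfderiv_comp x hΨd hιd]; rfl
      have h1 : mfderiv 𝓘(ℝ, E4) 𝓘(ℝ, E4) ι x (E4.basisVector 0) =
          (-1 : ℝ) • (E4.basisVector 0 : TangentSpace 𝓘(ℝ, E4) (ι x)) := by
        rw [neg_one_smul]; exact hιT x
      have e1 : mfderiv 𝓘(ℝ, E4) (𝓡 4) (Ψ ∘ ι) x (E4.basisVector 0) =
          mfderiv 𝓘(ℝ, E4) (𝓡 4) Ψ (ι x)
            ((-1 : ℝ) • (E4.basisVector 0 : TangentSpace 𝓘(ℝ, E4) (ι x))) := by rw [hc, h1]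
      have e2 : mfderiv 𝓘(ℝ, E4) (𝓡 4) Ψ (ι x)
            ((-1 : ℝ) • (E4.basisVector 0 : TangentSpace 𝓘(ℝ, E4) (ι x))) =
          (-1 : ℝ) • mfderiv 𝓘(ℝ, E4) (𝓡 4) Ψ (ι x) (E4.basisVector 0) :=
        ContinuousLinearMap.map_smul _ _ _
      have e3 : mfderiv 𝓘(ℝ, E4) (𝓡 4) (Ψ ∘ ι) x (E4.basisVector 0) =
          (-d) • 𝓑.killing (Ψ (ι x)) := by
        rw [e1, e2, hΨT (ι x), smul_smul, neg_one_mul]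
      exact e3
  · exact ⟨d, Ψ, hpos, hΨi, hΨr, hΨiso, hΨT⟩

end Summit.FinalStateConjecture.FinalStateConjecture.Theorems.SymplecticDualOfTheBomb

end
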